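import Summits.Ventures.PercRepro.S3MaxFlatSplit

/-!
# PercRepro — THE MAXIMAL-FLAT SPLIT AT ANY RANK (p7 g23; an S4 feeder, generalising p7 g22's S3MaxFlatSplit)

In a coloop-free matroid of rank `p` a set of rank `q < p` has at most `n − (p − q + 1)` points. THE SPLIT: either
some rank-`q` set attains `n − (p − q + 1)` points (the «maximal flat» case, handled by the flat kit), or every set
of rank `≤ q` has at most `n − (p − q + 2)` points (one flat-bound hypothesis of the LP cells' own shape). The three
numeral instances used at level `7`: a rank-`8` set with `n − 3` points at rank `10`; a rank-`7` set with `n − 4` points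
at rank `10`; a rank-`7` set with `n − 5` points at rank `11`. Nothing else is claimed.

* **`le_of_no_maxflat`**, `eight_le_of_no_maxflat_ten`, `seven_le_of_no_maxflat_ten`, `seven_le_of_no_maxflat_eleven`.
Axioms: standard.
-/

open scoped Matroid

namespace PercRepro

namespace S4Ups

open Set Finset

variable {α : Type} {M : Matroid α} [M.Finite]

/-- **THE SPLIT AT ANY RANK**: if no rank-`q` set has `n − (p − q + 1)` points, every set of rank `≤ q` has at most
`n − (p − q + 2)` points. -/
theorem le_of_no_maxflat {p q n : ℕ} (hM : M.eRank = (p : ℕ∞)) (hE : M.E.ncard = n) (hcol : M.coloops = ∅)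
    (hqp : q < p) (h : ¬ ∃ F ⊆ M.E, M.eRk F = (q : ℕ∞) ∧ F.ncard + (p - q + 1) = M.E.ncard) :
    ∀ X ⊆ M.E, M.eRk X ≤ (q : ℕ∞) → X.ncard ≤ n - (p - q + 2) := by
  intro X hX hXq
  by_contra hlt
  push Not at hlt
  have hfin : M.eRk X ≠ ⊤ := ne_top_of_le_ne_top (ENat.coe_ne_top q) hXq
  obtain ⟨a, ha⟩ := ENat.ne_top_iff_exists.mp hfin
  have haq : a ≤ q := by
    rw [← ha] at hXq
    exact_mod_cast hXq
  have hmiss := S1.sub_add_one_le_ncard_ground_sdiff_of_coloops M hM hcol hX ha.symm (by omega)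
  have hsum := ncard_sdiff_add_ncard_of_subset hX M.ground_finite
  have ha' : a = q := by omega
  apply h
  refine ⟨X, hX, ?_, by omega⟩
  rw [← ha, ha']

/-- Rank `10`: no rank-`8` set with `n − 3` points ⟹ every set of rank `≤ 8` has `≤ n − 4` points. -/
theorem eight_le_of_no_maxflat_ten {n : ℕ} (hM : M.eRank = ((10 : ℕ) : ℕ∞)) (hE : M.E.ncard = n) (hcol : M.coloops = ∅)
    (h : ¬ ∃ F ⊆ M.E, M.eRk F = ((8 : ℕ) : ℕ∞) ∧ F.ncard + 3 = M.E.ncard) :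
    ∀ X ⊆ M.E, M.eRk X ≤ 8 → X.ncard ≤ n - 4 :=
  le_of_no_maxflat hM hE hcol (by norm_num) h

/-- Rank `10`: no rank-`7` set with `n − 4` points ⟹ every set of rank `≤ 7` has `≤ n − 5` points. -/
theorem seven_le_of_no_maxflat_ten {n : ℕ} (hM : M.eRank = ((10 : ℕ) : ℕ∞)) (hE : M.E.ncard = n) (hcol : M.coloops = ∅)
    (h : ¬ ∃ F ⊆ M.E, M.eRk F = ((7 : ℕ) : ℕ∞) ∧ F.ncard + 4 = M.E.ncard) :
    ∀ X ⊆ M.E, M.eRk X ≤ 7 → X.ncard ≤ n - 5 :=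
  le_of_no_maxflat hM hE hcol (by norm_num) h

/-- Rank `11`: no rank-`7` set with `n − 5` points ⟹ every set of rank `≤ 7` has `≤ n − 6` points. -/
theorem seven_le_of_no_maxflat_eleven {n : ℕ} (hM : M.eRank = ((11 : ℕ) : ℕ∞)) (hE : M.E.ncard = n) (hcol : M.coloops = ∅)
    (h : ¬ ∃ F ⊆ M.E, M.eRk F = ((7 : ℕ) : ℕ∞) ∧ F.ncard + 5 = M.E.ncard) :
    ∀ X ⊆ M.E, M.eRk X ≤ 7 → X.ncard ≤ n - 6 :=
  le_of_no_maxflat hM hE hcol (by norm_num) h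

end S4Ups

end PercRepro
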